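import Summits.ResolutionOfSingularities.ResolutionOfSingularities.Theorems.WeightedInvariantE2LemmaH
import HarnessLib

/-!
# E2 centre, word (G-6b) `e2CentreHom`: LEMMA H at the GENERIC POINTS of `closure (maxLocus₂)` (no membership in `maxLocus₂`)

Route `ResolutionOfSingularities/WeightedInvariant`, crux `Theses.WeightedInvariant.HypersurfaceCentreConstruction`
(stmt-ResolutionOfSingularities-19897), door line `local-engine` (skeleton v3.12), E2 tier, registered stub `stub_e2_centre_h`, word (G-6b)
(`…ELadderTwoCentreOfHom`), proof route «LEMMA H» (`Cruxes/HypersurfaceCentreConstruction/G6B-LEMMA-H.md`).  …E2LemmaH proves LEMMA H for a point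
`η ∈ maxLocus₂` maximal in `closure (maxLocus₂)`.  But the associated points of `Γ(W) ⧸ Rₙ(W)` are the generic points `ξ` of the COMPONENTS of
`closure (maxLocus₂)`, which need NOT lie in `maxLocus₂` (e.g. `j = 0`: `maxLocus₂` = closed points, a component may be a curve).  This file
removes the membership hypothesis:
* `Stage.exists_corePoint_mem_closure_maxLocus₂` — for EVERY `η ∈ W ∩ maxLocus₂` the `𝒜`-core point `η*` (`𝔭_W(η*) = core_𝒜 𝔭_W(η)`) lies in
  `closure (maxLocus₂)` (…E2LemmaHCorePoint twice + the CLAIM of …E2LemmaHClosure; no maximality);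
* `Stage.isHomogeneous_primeIdealOf_of_maximal_closure` — **LEMMA H′**: for `ξ ∈ W ∩ closure (maxLocus₂)` maximal in `closure (maxLocus₂)`
  under generisation, `𝔭_W(ξ)` is `𝒜`-homogeneous: the core point `ξ*` lies in `closure (maxLocus₂)` because every basic open `D(s) ∋ ξ*` has a
  homogeneous component `s_d ∉ 𝔭_W(ξ)`, `D(s_d) ∋ ξ` meets `maxLocus₂` in some `η`, and then `η* ∈ D(s) ∩ closure (maxLocus₂)`; maximality
  gives `ξ* = ξ`.
Def-free helper (`--supports stmt-ResolutionOfSingularities-19897`); nothing here asserts any clause or anything about resolution of singularities in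
characteristic `p`; AI-written, weaker than expert review. [OURS · L1 W4.3]
-/

noncomputable section

set_option linter.dupNamespace false -- mandated namespace of this single-conjunct summit

open CategoryTheory AlgebraicGeometry TopologicalSpace IsLocalRing Topology
open Literature.AlgebraicGeometry.Resolution
open Summit.ResolutionOfSingularities.ResolutionOfSingularities.Theorems
open Summit.ResolutionOfSingularities.ResolutionOfSingularities.Cruxes.HypersurfaceCentreConstruction.LocalEngine

namespace Summit.ResolutionOfSingularities.ResolutionOfSingularities.Theorems.ELadderOne.Stage

variable {k : Type} [Field k] (S : Stage k) {p : ℕ} (ι : (R : Type) → [CommRing R] → R → Ordinal.{0})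
  (J : (R : Type) → [CommRing R] → R → ℕ → Ideal R)

/-- **The core point of a read point of the maximum locus lies in `closure (maxLocus₂)`** (for every grading of every affine open making
`𝓘(X)` homogeneous; under the graded HOM rung and (I0)₂). [folklore] -/
theorem exists_corePoint_mem_closure_maxLocus₂ [CharP k p] [PerfectField k] (hr : PRungGrHomLE 3 p ι J) (h0 : S.InvDim₂)
    (W : S.Y.affineOpens) {j' : ℕ} (𝒜 : (Fin j' → ℤ) → AddSubgroup Γ(S.Y, W)) [GradedRing 𝒜]
    (hXhom : (S.i.ker.ideal W).IsHomogeneous 𝒜) {η : S.Y} (hηW : η ∈ (W : S.Y.Opens)) (hη : η ∈ S.maxLocus₂ ι) :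
    ∃ (η₁ : S.Y) (hη₁W : η₁ ∈ (W : S.Y.Opens)),
      (W.2.primeIdealOf ⟨η₁, hη₁W⟩).asIdeal = (((W.2.primeIdealOf ⟨η, hηW⟩).asIdeal).homogeneousCore 𝒜).toIdeal ∧
      ((W.2.primeIdealOf ⟨η₁, hη₁W⟩).asIdeal).IsHomogeneous 𝒜 ∧ η₁ ⤳ η ∧ η₁ ∈ closure (S.maxLocus₂ ι) := by
  classical
  have hc6 : IotaIsoInvariant ι := hr.1.1
  have hc11 : IotaJEssSmoothCompatibleLE 3 ι J := hr.1.2.2.2.2.2.1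
  have hu : IotaUnitInvariant ι := hr.1.2.2.2.2.2.2.2.2.1
  obtain ⟨⟨hsing, -, hdim⟩, hιη⟩ := hη
  obtain ⟨η₁, hη₁W, hη₁P, hη₁hom, hη₁η, hdim₁, hι₁, hsing₁⟩ :=
    exists_corePoint ι J S.f S.i.ker S.isLocallyPrincipal W 𝒜 hc6 hc11 hu hXhom hηW hdim
  refine ⟨η₁, hη₁W, hη₁P, hη₁hom, hη₁η, ?_⟩
  -- a unit chart through `η`, hence through `η₁`; the core point `η₂` of `η₁` for the atlas grading
  obtain ⟨x, hx⟩ := S.mem_range_of_mem_singImage hsing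
  obtain ⟨a, hxa, ha⟩ := S.exists_isUnitChart x
  have hηa : η ∈ (S.atlas.W a : S.Y.Opens) := hx ▸ hxa
  have hη₁a : η₁ ∈ (S.atlas.W a : S.Y.Opens) := hη₁η.mem_open (S.atlas.W a : S.Y.Opens).2 hηa
  letI := S.atlas.gradedRing a
  obtain ⟨η₂, hη₂a, -, hη₂hom, hη₂η₁, -, hι₂, hsing₂⟩ :=
    exists_corePoint ι J S.f S.i.ker S.isLocallyPrincipal (S.atlas.W a) (S.atlas.piece a) hc6 hc11 hu
      (S.atlas.isHomogeneous_ker a) hη₁a (hdim₁.trans hdim)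
  have hμ : S.mu₂ ι ≤ iotaAt ι S.i.ker η₂ := (hι₂.trans (hι₁.trans hιη)).ge
  exact S.closure_inter_chart_subset_closure_maxLocus₂_of_isHomogeneous ι J hr h0 ha hη₂a hη₂hom hμ (hsing₂ (hsing₁ hsing))
    ⟨specializes_iff_mem_closure.mp hη₂η₁, hη₁a⟩

/-- **LEMMA H′ (generic-point form).**  Under the graded HOM rung and (I0)₂: for an affine open `W`, a `ℤʲ'`-grading `𝒜` of `Γ(S.Y, W)` making
`𝓘(X)(W)` homogeneous, and `ξ ∈ W ∩ closure (maxLocus₂)` maximal in `closure (maxLocus₂)` under generisation (the generic point of an irreducible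
component — NOT assumed in `maxLocus₂`), the prime `𝔭_W(ξ)` is `𝒜`-homogeneous. [folklore] -/
theorem isHomogeneous_primeIdealOf_of_maximal_closure [CharP k p] [PerfectField k] (hr : PRungGrHomLE 3 p ι J) (h0 : S.InvDim₂)
    (W : S.Y.affineOpens) {j' : ℕ} (𝒜 : (Fin j' → ℤ) → AddSubgroup Γ(S.Y, W)) [GradedRing 𝒜]
    (hXhom : (S.i.ker.ideal W).IsHomogeneous 𝒜) {ξ : S.Y} (hξW : ξ ∈ (W : S.Y.Opens)) (hξ : ξ ∈ closure (S.maxLocus₂ ι))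
    (hmax : ∀ y' ∈ closure (S.maxLocus₂ ι), y' ⤳ ξ → ξ ⤳ y') :
    ((W.2.primeIdealOf ⟨ξ, hξW⟩).asIdeal).IsHomogeneous 𝒜 := by
  classical
  set 𝔮 := (W.2.primeIdealOf ⟨ξ, hξW⟩).asIdeal with h𝔮
  set 𝔮c := (𝔮.homogeneousCore 𝒜).toIdeal with h𝔮c
  haveI h𝔮cp : 𝔮c.IsPrime := E2Model.isPrime_homogeneousCore 𝒜 (W.2.primeIdealOf ⟨ξ, hξW⟩).2
  have hchom : 𝔮c.IsHomogeneous 𝒜 := (𝔮.homogeneousCore 𝒜).isHomogeneous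
  have hle : 𝔮c ≤ 𝔮 := Ideal.toIdeal_homogeneousCore_le _ _
  obtain ⟨ξ₁, hξ₁W, hξ₁P⟩ := exists_point_primeIdealOf_eq W 𝔮c h𝔮cp
  have hξ₁ξ : ξ₁ ⤳ ξ := specializes_of_primeIdealOf_le W hξW hξ₁W (hξ₁P ▸ hle)
  -- the core point `ξ₁` lies in `closure (maxLocus₂)`
  have hξ₁M : ξ₁ ∈ closure (S.maxLocus₂ ι) := by
    rw [mem_closure_iff]
    intro O hO hξ₁O
    obtain ⟨s, hsO, hξ₁s⟩ := W.2.exists_basicOpen_le (V := ⟨O, hO⟩ ⊓ (W : S.Y.Opens)) ⟨ξ₁, ⟨hξ₁O, hξ₁W⟩⟩ hξ₁W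
    have hsξ₁ : s ∉ (W.2.primeIdealOf ⟨ξ₁, hξ₁W⟩).asIdeal := (mem_basicOpen_iff_not_mem W hξ₁W s).mp hξ₁s
    rw [hξ₁P] at hsξ₁
    obtain ⟨d, hd⟩ := E2Model.exists_decompose_not_mem 𝒜 hchom hsξ₁
    -- the homogeneous component `s_d` does not vanish at `ξ`
    have hdξ : (DirectSum.decompose 𝒜 s d : Γ(S.Y, W)) ∉ 𝔮 := fun h =>
      hd (Ideal.mem_homogeneousCore_of_homogeneous_of_mem ⟨d, SetLike.coe_mem _⟩ h)
    have hξsd : ξ ∈ S.Y.basicOpen (DirectSum.decompose 𝒜 s d : Γ(S.Y, W)) := (mem_basicOpen_iff_not_mem W hξW _).mpr hdξ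
    -- so `D(s_d)` meets `maxLocus₂` in some `η`, whose core point `η₁` lies in `D(s) ∩ closure (maxLocus₂)`
    obtain ⟨η, hηsd, hηM⟩ := mem_closure_iff.mp hξ _ (S.Y.basicOpen _).2 hξsd
    have hηW : η ∈ (W : S.Y.Opens) := S.Y.basicOpen_le _ hηsd
    obtain ⟨η₁, hη₁W, hη₁P, hη₁hom, -, hη₁M⟩ := S.exists_corePoint_mem_closure_maxLocus₂ ι J hr h0 W 𝒜 hXhom hηW hηM
    have hsdη : (DirectSum.decompose 𝒜 s d : Γ(S.Y, W)) ∉ (W.2.primeIdealOf ⟨η, hηW⟩).asIdeal :=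
      (mem_basicOpen_iff_not_mem W hηW _).mp hηsd
    have hsdη₁ : (DirectSum.decompose 𝒜 s d : Γ(S.Y, W)) ∉ (W.2.primeIdealOf ⟨η₁, hη₁W⟩).asIdeal := fun h =>
      hsdη (Ideal.toIdeal_homogeneousCore_le _ _ (hη₁P ▸ h))
    have hsη₁ : s ∉ (W.2.primeIdealOf ⟨η₁, hη₁W⟩).asIdeal := fun h => hsdη₁ (hη₁hom d h)
    have hη₁s : η₁ ∈ S.Y.basicOpen s := (mem_basicOpen_iff_not_mem W hη₁W s).mpr hsη₁
    obtain ⟨η', hη'O, hη'M⟩ := mem_closure_iff.mp hη₁M O hO (hsO hη₁s).1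
    exact ⟨η', hη'O, hη'M⟩
  -- maximality: `ξ₁ = ξ`
  have e : ξ₁ = ξ := (hξ₁ξ.antisymm (hmax ξ₁ hξ₁M hξ₁ξ)).eq
  subst e
  rw [h𝔮, hξ₁P]
  exact hchom

end Summit.ResolutionOfSingularities.ResolutionOfSingularities.Theorems.ELadderOne.Stage

end
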